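import Mathlib

/-!
# SEIL-F outer end: the critical-layer (Scorer) scalings as exact algebra (solo-blind s85, kernel #190)

In the physical-angle variables of the deleted leaf chain (kernels #186, #188) the streak
component of the frame solves, near the critical layer `θ = π/2` (`x = θ - π/2`), the frozen
equation `K V'' - i β x V = -i βₓ` with `β = 2P h` (Doppler slope) and `βₓ = 2P hₓ` (forcing).
With the layer width `δ` defined by `δ³ = K/β` and `x = δ η` this becomes
`(K/δ²)(Y'' - i η Y) = -i βₓ`, `V = H · Y(η)` with the Scorer profile `Y'' - iηY = -i` and the
layer height `H = βₓ δ²/K`.  This file records the exact algebra behind the three scalings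
used in paper §24.106 (4) and PLAN §107 (g):

* `layer_balance`: `K/δ² = β δ` (diffusion across the layer = Doppler detuning across it);
* `layer_excess`: `H · δ = βₓ/β` — height × width is `P`-free (`= hₓ/h`), which is why the
  layer contributes a `P`-independent excess moment `i π hₓ/(2h)`;
* `layer_height_cubed`: `H³ = βₓ³/(K β²)`, i.e. `H = (2P)^{1/3} hₓ h^{-2/3} K^{-1/3}`;
* `layer_lifetime`: with the Kelvin-mode lifetime `τ³ = 12/(K β²)` of kernel #189,
  `(β δ τ)³ = 12` — the Doppler phase accumulated across one layer width during one
  lifetime is the pure number `12^{1/3}`.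
-/

namespace Summit.AnomalousDissipation.AnomalousDissipation.Theorems

/-- Diffusion/Doppler balance defining the layer: `δ³ = K/β` gives `K/δ² = β δ`. -/
theorem layer_balance {K β δ : ℝ} (hβ : β ≠ 0) (hδ : δ ≠ 0) (h : δ ^ 3 = K / β) :
    K / δ ^ 2 = β * δ := by
  have hK : K = β * δ ^ 3 := by rw [h]; field_simp
  rw [hK]; field_simp

/-- Height × width of the layer is `P`-free: `(βₓ δ²/K) · δ = βₓ/β`. -/
theorem layer_excess {K β βx δ : ℝ} (hK : K ≠ 0) (hβ : β ≠ 0) (h : δ ^ 3 = K / β) :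
    βx * δ ^ 2 / K * δ = βx / β := by
  have : βx * δ ^ 2 / K * δ = βx * δ ^ 3 / K := by ring
  rw [this, h]; field_simp

/-- The layer height cubed: `H³ = βₓ³/(K β²)` for `H = βₓ δ²/K`, `δ³ = K/β`. -/
theorem layer_height_cubed {K β βx δ : ℝ} (hK : K ≠ 0) (hβ : β ≠ 0) (h : δ ^ 3 = K / β) :
    (βx * δ ^ 2 / K) ^ 3 = βx ^ 3 / (K * β ^ 2) := by
  have h6 : δ ^ 6 = (K / β) ^ 2 := by rw [← h]; ring
  have : (βx * δ ^ 2 / K) ^ 3 = βx ^ 3 * δ ^ 6 / K ^ 3 := by ring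
  rw [this, h6]; field_simp

/-- Layer width × Doppler slope × Kelvin lifetime is the pure number `12^{1/3}`:
`δ³ = K/β`, `τ³ = 12/(K β²)` give `(β δ τ)³ = 12`. -/
theorem layer_lifetime {K β δ τ : ℝ} (hK : K ≠ 0) (hβ : β ≠ 0) (hδ : δ ^ 3 = K / β)
    (hτ : τ ^ 3 = 12 / (K * β ^ 2)) : (β * δ * τ) ^ 3 = 12 := by
  have : (β * δ * τ) ^ 3 = β ^ 3 * δ ^ 3 * τ ^ 3 := by ring
  rw [this, hδ, hτ]; field_simp

/-- The bulk law is the outer limit of the layer: `H · (1/η) = (βₓ/β)/x` for `x = δ η`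
(so `V → (hₓ/h)/x = -(hₓ/h) sin²θ/cos θ` to leading order away from the layer). -/
theorem layer_matches_bulk {K β βx δ η : ℝ} (hK : K ≠ 0) (hβ : β ≠ 0) (hδ0 : δ ≠ 0)
    (hη : η ≠ 0) (h : δ ^ 3 = K / β) :
    βx * δ ^ 2 / K * (1 / η) = βx / β / (δ * η) := by
  have hx := layer_excess (βx := βx) hK hβ h
  field_simp
  have hK' : K = β * δ ^ 3 := by rw [h]; field_simp
  rw [hK']; ring

end Summit.AnomalousDissipation.AnomalousDissipation.Theorems
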